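import Summits.AtomisticToContinuum.HydrodynamicLimit.Theorems.CollisionIsometryCLTDiffuseBackwardInfluencePairGeneric
import Summits.AtomisticToContinuum.HydrodynamicLimit.Theorems.CollisionIsometryCLTDiffuseBackwardInfluencePairFunctionals
import Summits.AtomisticToContinuum.HydrodynamicLimit.Theorems.CollisionIsometryCLTDiffuseBackwardInfluencePairSlots
import Summits.AtomisticToContinuum.HydrodynamicLimit.Theorems.CollisionIsometryCLTDiffuseBackwardInfluencePairProcess
import HarnessLib

/-!
# `DiffuseBackwardInfluence`, line `share-nondegeneracy-one-flight`, skeleton v8 — helper PROC2: the three functionals ALONG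
the marked pair process of one source (stmt-AtomisticToContinuum-12950, for `stub_pairPathBoundT`)

For the marked pair process `Tm C n` / `Am C n` of one source `C : OnePath.Src N` (`…PairDefs` §3, stepped with the effective
score increment `dltR` of `…PairProcess`), in the mark box `K + 2` and for every `n ≤ K`: §W the WEIGHT
`Σ 2^{-s} (1 − η(1−η))^{-t} · mass` is `≤ 1` along the window (geometric supermartingale: `weight_step` + `score_condition`;
registered headline `pairPath_weight_le_one`); §SM the SPLIT MOMENT `Σ s·T + Σ (s−1)·A` equals the accumulated merge mass
`Σ_{c<n} mergeAt c` (`splitMoment_step` + `remFlow_eq_mergeAt`); §DF the SCORE DEFICIT against the resolved-slot count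
`cnt n − gap n i` equals the accumulated resolution charges `chargeAt` plus lag payments `lagAt` (`deficit_step` with the gap
bookkeeping `gap_succ_of_touches` / `gap_succ_of_not_touches`).
-/

namespace Summit.AtomisticToContinuum.HydrodynamicLimit.Theorems.DiffuseBackwardInfluenceShare

open scoped BigOperators Topology ENNReal InnerProductSpace Classical
open Filter Set MeasureTheory
open Literature.Analysis.FluidPDE (Config HardSphereFlow collidePair)
open Literature.MathematicalPhysics.KineticTheory (localGibbsLaw hsDiameter)
open Summit.AtomisticToContinuum.HydrodynamicLimit.Theorems.DiffuseBackwardInfluenceNeg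

noncomputable section

namespace PairPath

section Process

variable {N : ℕ} {C : OnePath.Src N}

/-! ### §W The weight stays below one -/

/-- The weight parameter `ρ₁ = 1 − η(1−η)` lies in `(0, 1]` for `η ∈ [0, 1]`. [folklore] -/
theorem rho_mem {η : ℝ} (h0 : 0 ≤ η) (h1 : η ≤ 1) : 0 < 1 - η * (1 - η) ∧ 1 - η * (1 - η) ≤ 1 :=
  ⟨by nlinarith [sq_nonneg (η - 1 / 2)], by nlinarith [mul_nonneg h0 (sub_nonneg.2 h1)]⟩

/-- THE SUPERMARTINGALE ALONG THE PROCESS: the weighted mass `Σ 2^{-s} ρ₁^{-t}` of the marked process is `≤ 1` at every step of the window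
(it is `1` at `n = 0` and never increases: `weight_step` with the effective increment and the score condition). [folklore] -/
theorem weight_le_one (hΔ : 0 < C.Δ) (hpos : 0 < OnePath.fin C) (hm : 1 ≤ C.m) (hL : 1 ≤ C.L) (hη0 : 0 ≤ C.η) (hη1 : C.η ≤ 1)
    (K : ℕ) : ∀ n, n ≤ K → n ≤ OnePath.fin C →
      wT (1 / 2) (1 - C.η * (1 - C.η)) (K + 2) (Tm C n) + wA (1 / 2) (1 - C.η * (1 - C.η)) (K + 2) (S C) (Am C n) ≤ 1 := by
  intro n
  induction n with
  | zero =>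
    intro _ _
    -- at time `0` all the mass sits together on the source with no split and no score: weight `1`
    have hT : wT (1 / 2) (1 - C.η * (1 - C.η)) (K + 2) (Tm C 0) = 1 := by
      simp only [wT, Tm_zero]
      rw [Finset.sum_eq_single C.k (fun i _ hi => by simp [hi]) fun hk => absurd (Finset.mem_univ _) hk,
        Finset.sum_eq_single 0 (fun s _ hs => by simp [hs]) fun h0 => absurd (Finset.mem_range.2 (by omega)) h0,
        Finset.sum_eq_single 0 (fun t _ ht => by simp [ht]) fun h0 => absurd (Finset.mem_range.2 (by omega)) h0]
      simp
    have hA : wA (1 / 2) (1 - C.η * (1 - C.η)) (K + 2) (S C) (Am C 0) = 0 := by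
      simp only [wA, Am_zero, mul_zero, Finset.sum_const_zero]
    rw [hT, hA, add_zero]
  | succ n ih =>
    intro hK hf
    have ih' := ih (Nat.le_of_succ_le hK) (Nat.le_of_succ_le hf)
    by_cases h : (pairsAt C.σ N C.y n).Nonempty
    · -- a reflecting step: `weight_step` with the effective increment `dltR` and the score condition
      obtain ⟨hT, hA⟩ := Tm_succ_eq_dltR h
      have hU : 1 ≤ K + 2 := by omega
      have hTs : ∀ i t, Tm C n i (K + 2 - 1) t = 0 := fun i t => Tm_eq_zero_of n i (Or.inl (by omega))
      have hTt : ∀ i s, Tm C n i s (K + 2 - 1) = 0 := fun i s => Tm_eq_zero_of n i (Or.inr (by omega))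
      have hAg : ∀ i j s t g, S C < g → Am C n i j s t g = 0 := fun i j s t g hg =>
        Am_eq_zero_of n i j (Or.inr (Or.inr hg))
      obtain ⟨hρ0, hρ1⟩ := rho_mem hη0 hη1
      rw [hT, hA]
      refine le_trans ?_ ih'
      exact weight_step (some_fst_ne_some_snd h) (OnePath.fr_nonneg _ _) (OnePath.fr_le_one _ _) (OnePath.fr_nonneg _ _)
        (OnePath.fr_le_one _ _) (dltR_le_one n _ _) (fun i hp hq => dltR_of_ne hp hq) (by norm_num) (by norm_num) hρ0 hρ1
        hU (S C) (cnt C n) (Tm_nonneg n) (Am_nonneg n) hTs hTt hAg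
        fun i hi => score_condition hΔ hpos hm hL (by omega) h i hi
    · -- an idle step: nothing moves
      rw [Tm_succ_of_not h, Am_succ_of_not h]
      exact ih'

/-! ### §SM The split moment equals the accumulated merge mass -/

/-- THE SPLIT MOMENT ALONG THE PROCESS: `Σ s·(together) + Σ (s−1)·(apart) = Σ_{c<n} mergeAt(c)` (exact). [folklore] -/
theorem splitMoment_eq (K : ℕ) : ∀ n, n ≤ K →
    smT (K + 2) (Tm C n) + smA (K + 2) (S C) (Am C n) = ∑ c ∈ Finset.range n, mergeAt C.σ N C.y C.k c := by
  intro n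
  induction n with
  | zero =>
    intro _
    -- at time `0` the together mass has `s = 0` and there is no apart mass
    rw [Finset.sum_range_zero]
    have hT : smT (K + 2) (Tm C 0) = 0 := by
      simp only [smT, Tm_zero]
      refine Finset.sum_eq_zero fun i _ => Finset.sum_eq_zero fun s _ => Finset.sum_eq_zero fun t _ => ?_
      split_ifs with h
      · obtain ⟨-, rfl, -⟩ := h
        rw [Nat.cast_zero, zero_mul]
      · rw [mul_zero]
    have hA : smA (K + 2) (S C) (Am C 0) = 0 := by
      simp only [smA, Am_zero, mul_zero, Finset.sum_const_zero]
    rw [hT, hA, add_zero]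
  | succ n ih =>
    intro hK
    rw [Finset.sum_range_succ, ← ih (Nat.le_of_succ_le hK)]
    by_cases h : (pairsAt C.σ N C.y n).Nonempty
    · -- a reflecting step: `splitMoment_step` adds the re-merge flow, which is `mergeAt`
      obtain ⟨hT, hA⟩ := Tm_succ_eq_dltR h
      have hU : 1 ≤ K + 2 := by omega
      have hTs : ∀ i t, Tm C n i (K + 2 - 1) t = 0 := fun i t => Tm_eq_zero_of n i (Or.inl (by omega))
      have hTt : ∀ i s, Tm C n i s (K + 2 - 1) = 0 := fun i s => Tm_eq_zero_of n i (Or.inr (by omega))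
      rw [hT, hA, splitMoment_step (some_fst_ne_some_snd h) (OnePath.fr C n) (dltR_le_one n _ _) hU (cnt_le n) hTs hTt
        (Am_diag n), remFlow_eq_mergeAt (Nat.le_of_succ_le hK) h]
    · -- an idle step: nothing moves and `mergeAt = 0`
      rw [Tm_succ_of_not h, Am_succ_of_not h, mergeAt_of_not_nonempty h, add_zero]

/-! ### §DF The deficit equals the accumulated charges and lags -/

variable (C) in
/-- The RESOLUTION CHARGE of step `c` (box `K + 2`): for each host of the reflected pair, (pending slots − effective score) × its together
mass; `0` at an idle step. -/
def chargeAt (K c : ℕ) : ℝ :=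
  if h : (pairsAt C.σ N C.y c).Nonempty then
    ((gap C c h.some.1 : ℝ) - (dltR C c h.some.1 h.some.2 h.some.1 : ℝ)) * sT (K + 2) (Tm C c) h.some.1 +
      ((gap C c h.some.2 : ℝ) - (dltR C c h.some.1 h.some.2 h.some.2 : ℝ)) * sT (K + 2) (Tm C c) h.some.2
  else 0

variable (C) in
/-- The LAG PAYMENT of step `c` (box `K + 2`): the re-merge flow of each tag `g` times its lag `cnt c − g`; `0` at an idle step. -/
def lagAt (K c : ℕ) : ℝ :=
  if h : (pairsAt C.σ N C.y c).Nonempty then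
    ∑ g ∈ Finset.range (S C + 1), ((cnt C c : ℝ) - (g : ℝ)) * remFlowTag h.some.1 h.some.2 (OnePath.fr C c) (K + 2) (Am C c) g
  else 0

/-- THE DEFICIT ALONG THE PROCESS (exact bookkeeping): with the resolved-slot count `e_n(i) = cnt n − gap n i` of the hosts,
`Σ (e_n(i) − t)·T_n + Σ (g − t)·A_n = Σ_{c<n} (chargeAt c + lagAt c)`. [folklore] -/
theorem deficit_eq (K : ℕ) : ∀ n, n ≤ K →
    dfT (fun i => (cnt C n : ℝ) - (gap C n i : ℝ)) (K + 2) (Tm C n) + dfA (K + 2) (S C) (Am C n) =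
      ∑ c ∈ Finset.range n, (chargeAt C K c + lagAt C K c) := by
  intro n
  induction n with
  | zero =>
    intro _
    -- at time `0` the together mass sits at `t = 0` with `cnt 0 − gap 0 = 0` resolved slots; no apart mass
    rw [Finset.sum_range_zero]
    have hT : dfT (fun i => (cnt C 0 : ℝ) - (gap C 0 i : ℝ)) (K + 2) (Tm C 0) = 0 := by
      simp only [dfT, Tm_zero]
      refine Finset.sum_eq_zero fun i _ => Finset.sum_eq_zero fun s _ => Finset.sum_eq_zero fun t _ => ?_
      split_ifs with h
      · obtain ⟨-, -, rfl⟩ := h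
        rw [gap_zero, Nat.cast_zero, sub_zero, sub_self, zero_mul]
      · rw [mul_zero]
    have hA : dfA (K + 2) (S C) (Am C 0) = 0 := by
      simp only [dfA, Am_zero, mul_zero, Finset.sum_const_zero]
    rw [hT, hA, add_zero]
  | succ n ih =>
    intro hK
    rw [Finset.sum_range_succ, ← ih (Nat.le_of_succ_le hK)]
    have hcnt : cnt C n ≤ cnt C (n + 1) := cnt_mono (Nat.le_succ n)
    by_cases h : (pairsAt C.σ N C.y n).Nonempty
    · -- a reflecting step: `deficit_step` with the resolved-slot counts before/after; the hosts restart at `cnt n`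
      obtain ⟨hT, hA⟩ := Tm_succ_eq_dltR h
      have hU : 1 ≤ K + 2 := by omega
      have hTs : ∀ i t, Tm C n i (K + 2 - 1) t = 0 := fun i t => Tm_eq_zero_of n i (Or.inl (by omega))
      have hTt : ∀ i s, Tm C n i s (K + 2 - 1) = 0 := fun i s => Tm_eq_zero_of n i (Or.inr (by omega))
      have he' : ∀ i, i ≠ h.some.1 → i ≠ h.some.2 →
          (cnt C (n + 1) : ℝ) - (gap C (n + 1) i : ℝ) = (cnt C n : ℝ) - (gap C n i : ℝ) := by
        intro i hp hq
        have hi : ¬ Touches C.σ N C.y n i := fun ht => by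
          rcases (touches_iff_of h i).1 ht with h1 | h1
          exacts [hp h1, hq h1]
        rw [gap_succ_of_not_touches hi, Nat.cast_add, Nat.cast_sub hcnt]
        ring
      have hep : (cnt C (n + 1) : ℝ) - (gap C (n + 1) h.some.1 : ℝ) = (cnt C n : ℝ) := by
        rw [gap_succ_of_touches ((touches_iff_of h _).2 (Or.inl rfl)), Nat.cast_sub hcnt]
        ring
      have heq : (cnt C (n + 1) : ℝ) - (gap C (n + 1) h.some.2 : ℝ) = (cnt C n : ℝ) := by
        rw [gap_succ_of_touches ((touches_iff_of h _).2 (Or.inr rfl)), Nat.cast_sub hcnt]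
        ring
      rw [hT, hA, deficit_step (some_fst_ne_some_snd h) (OnePath.fr C n) (dltR_le_one n _ _) hU (cnt_le n) hTs hTt
        (Am_diag n) (e := fun i => (cnt C n : ℝ) - (gap C n i : ℝ))
        (e' := fun i => (cnt C (n + 1) : ℝ) - (gap C (n + 1) i : ℝ)) he' hep heq]
      simp only [chargeAt, lagAt, dif_pos h]
      ring
    · -- an idle step: nothing moves, every particle keeps its resolved-slot count, no charge and no lag
      have he : ∀ i, (cnt C (n + 1) : ℝ) - (gap C (n + 1) i : ℝ) = (cnt C n : ℝ) - (gap C n i : ℝ) := by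
        intro i
        rw [gap_succ_of_not_touches (not_touches_of_not h i), Nat.cast_add, Nat.cast_sub hcnt]
        ring
      simp only [he]
      rw [Tm_succ_of_not h, Am_succ_of_not h]
      simp only [chargeAt, lagAt, dif_neg h, add_zero]

end Process

/-- REGISTERED HEADLINE (sub-goal `pairPath_weight_le_one`): the supermartingale along the marked pair process. [folklore] -/
theorem pairPath_weight_le_one : ∀ (N : ℕ) (C : OnePath.Src N), 0 < C.Δ → 0 < OnePath.fin C → 1 ≤ C.m → 1 ≤ C.L → 0 ≤ C.η → C.η ≤ 1 → ∀ (K n : ℕ), n ≤ K → n ≤ OnePath.fin C → PairPath.wT (1 / 2) (1 - C.η * (1 - C.η)) (K + 2) (PairPath.Tm C n) + PairPath.wA (1 / 2) (1 - C.η * (1 - C.η)) (K + 2) (PairPath.S C) (PairPath.Am C n) ≤ 1 :=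
  fun _ _ hΔ hpos hm hL h0 h1 K n hn hf => weight_le_one hΔ hpos hm hL h0 h1 K n hn hf

end PairPath

end

end Summit.AtomisticToContinuum.HydrodynamicLimit.Theorems.DiffuseBackwardInfluenceShare
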